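import Summits.AtomisticToContinuum.HydrodynamicLimit.Theses.OneFlightGossipEngine
import Summits.AtomisticToContinuum.HydrodynamicLimit.Theorems.TransferActivityTails.Negative.EquilibriumReduction
import Summits.AtomisticToContinuum.HydrodynamicLimit.Theorems.OneFlightGossipEngineCollisionActivityTailsMeanEnergyBound
import Summits.AtomisticToContinuum.HydrodynamicLimit.Theorems.OneFlightGossipEngineCollisionActivityTailsActMeasurable
import HarnessLib

/-!
# `EnergyActivityTails` (stmt-AtomisticToContinuum-17703), line `Sketch` (coboundary-hot-cold-split): the tail assembly

Helper file (`--supports stmt-AtomisticToContinuum-17703`) for the crux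
`Summit.AtomisticToContinuum.HydrodynamicLimit.Theses.OneFlightGossipEngine.EnergyActivityTails`, skeleton line
`Sketch` (`Cruxes/EnergyActivityTails/Lines/Sketch.lean`), registered stub `stub_tailAssembly` (K4 of the line; the
line vocabulary `Cfg`, `hotSupplyOf`, `HotSupplyTailsIn`, `PathwiseSplit`, `HotSupplyMeasurable` is re-declared
verbatim from the skeleton).

**The reduction.** The crux is, definitionally, the pre-shock window-activity tail statement `TailsOf energyOf` of
`Theorems/TransferActivityTails/Negative/EquilibriumReduction.lean` for the ENERGY impulse
`aᵉ_i = (σ/τ) Σ_{collisions of i in (s, s+w]} |‖v_i⁺‖² − ‖v_i⁻‖²|/2`, `w = τ (N+1)^{-1/3}`, and its momentum twin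
`CollisionActivityTails` (CAT, crux stmt-13734) is `TailsOf momentumOf` (`aᵐ_i`, summand `‖v_i⁺ − v_i⁻‖`).  Given

* the PATHWISE SPLIT at a cap `M ≥ 0` (K3 of the line): on every good orbit
  `Σ_{(a,b]} |ΔE_i| ≤ ‖v_i(a)‖²/2 + 2M Σ_{(a,b]} ‖Δv_i‖ + 2 Σ_{(a,b]} hotSupply_M`,
* the measurability of the hot-supply window sum in the datum,
* CAT, and
* the HOT-SUPPLY TAILS `HotSupplyTailsIn` (the crux frame with the summand `hotSupplyOf M`, `∃ M > 0` chosen after `t`),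

the crux follows by the scalar tail algebra `𝟙{V < a} a ≤ 3 (x₁ + 𝟙{V/3 < x₂} x₂ + 𝟙{V/3 < x₃} x₃)` for
`0 ≤ a ≤ x₁ + x₂ + x₃` (`tailFn_le_three_mul`) and `𝟙{W < c y} c y ≤ c 𝟙{W' < y} y` for `c W' ≤ W`
(`tailFn_const_mul_le`): a.e. on the good set (which carries the local Gibbs law, `ae_mem_good_localGibbsLaw`)

`(N+1)⁻¹ Σ_i 𝟙{V < aᵉ_i} aᵉ_i ≤ 3 (σ/τ) (N+1)⁻¹ E(z) + 6M (N+1)⁻¹ Σ_i 𝟙{V/(6M) < aᵐ_i} aᵐ_i + 6 (N+1)⁻¹ Σ_i 𝟙{V/6 < h_i} h_i`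

(`E` the conserved kinetic energy, `HardSphereFlow.configEnergy_flow`), and the three means are `≤ ε/3` each: the
first by the landed `MeanEnergyBound` (`∫ E dλ_N ≤ e₀ (N+1)`) once `τ ≥ 9 σ e₀ / ε`, the second by CAT at level
`V/(6M)` and accuracy `ε/(18M)`, the third by `HotSupplyTailsIn` at level `V/6` and accuracy `ε/18`; the `lintegral`
splits because the last two integrands are a.e.-measurable (`aemeasurable_sum_tailFn_act`, `HotSupplyMeasurable`).
Quantifier bookkeeping: `σ₀ := min (min σ₀ᵐ σ₀ʰ) (1/2)`, `V₀ := max (6 M V₀ᵐ) (6 V₀ʰ)`,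
`τ₀ := max (max τ₀ᵐ τ₀ʰ) (9 σ e₀ / ε)`, `N₀ := max N₀ᵐ N₀ʰ` — the cap `M` is chosen after `t` and before `V₀`, so
no quantifier is inverted.

References: the Chebyshev-type tail algebra is folklore; H. Spohn, *Large Scale Dynamics of Interacting Particles*
(1991), Part I §2.3 (local equilibrium states); C. Cercignani, R. Illner, M. Pulvirenti, *The Mathematical Theory of
Dilute Gases* (1994), §4.2 (the hard-sphere flow, energy conservation).
-/

noncomputable section

open MeasureTheory Filter Set Topology
open scoped ENNReal InnerProductSpace

namespace Summit.AtomisticToContinuum.HydrodynamicLimit.Theorems.EnergyActivityTailsTailAssembly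

open Literature.MathematicalPhysics.KineticTheory Literature.Analysis.FluidPDE
open Summit.AtomisticToContinuum.HydrodynamicLimit.Theorems.TransferActivityTailsNegative
  (Flow Rec energyOf momentumOf TailsOf collisionSum_nonneg momentumOf_nonneg)
open Summit.AtomisticToContinuum.HydrodynamicLimit.Theorems.CollisionActivityTailsActivityDomination
  (window act window_pos)
open Summit.AtomisticToContinuum.HydrodynamicLimit.Theorems.CollisionActivityTailsNearFieldKineticTails
  (tailFn tailFn_of_lt tailFn_of_le tailFn_nonneg measurable_tailFn)
open Summit.AtomisticToContinuum.HydrodynamicLimit.Theorems.CollisionActivityTailsEndpointTails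
  (ae_mem_good_localGibbsLaw lintegral_ofReal_le_of_le_mul)
open Summit.AtomisticToContinuum.HydrodynamicLimit.Theorems.CollisionActivityTailsWindowAlgebra
  (aemeasurable_sum_tailFn_act act_nonneg)
open Summit.AtomisticToContinuum.HydrodynamicLimit.Theorems.CollisionActivityTailsMeanEnergyBound
  (stub_meanEnergyBound)

/-! ## §0 Vocabulary of the line (verbatim from the skeleton `Sketch`) -/

/-- Configurations of `N + 1` spheres on `𝕋³`. -/
abbrev Cfg (N : ℕ) : Type := Config (N + 1) (Fin 3) T3

/-- **Hot supply at cap `M`**: the energy RECEIVED by `i` (positive part of its gain) in a collision whose partner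
arrives with normal speed `|⟪v_snd⁻, ω⟫| > M` (`ω = c.impactVec`); zero on every collision with a cold-normal
partner (registered vocabulary of line Sketch, crux EnergyActivityTails (stmt-AtomisticToContinuum-17703) —
route-internal, not a cited fact). -/
def hotSupplyOf (M : ℝ) (N : ℕ) (i : Fin (N + 1)) (c : Rec N) : ℝ :=
  if c.fst = i ∧ M < |⟪c.preVel.2, c.impactVec⟫_ℝ| then max ((‖c.postVel.1‖ ^ 2 - ‖c.preVel.1‖ ^ 2) / 2) 0 else 0

/-- `HSTin` — **hot-supply tails, cap inside the frame**: the crux's frame verbatim with the summand `hotSupplyOf M`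
and `∃ M > 0` inserted after `t` (before `V₀`) (registered vocabulary of line Sketch, crux EnergyActivityTails
(stmt-AtomisticToContinuum-17703) — route-internal, not a cited fact). -/
def HotSupplyTailsIn : Prop :=
  ∀ (a₀ θ₀ : T3 → ℝ) (u₀ : T3 → V3), Continuous a₀ → Continuous θ₀ → Continuous u₀ →
    (∀ x, 0 < a₀ x) → (∀ x, 0 < θ₀ x) → ∃ σ₀ : ℝ, 0 < σ₀ ∧ ∀ σ : ℝ, 0 < σ → σ < σ₀ →
    ∀ (T : ℝ) (ρ θ : ℝ → T3 → ℝ) (u : ℝ → T3 → V3), IsHardSphereEulerSolution σ T ρ u θ →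
    ∀ Φ : (N : ℕ) → Flow σ N,
    TendstoHydroFieldsAt (fun N => localGibbsLaw σ a₀ u₀ θ₀ N (Φ N)) Φ ρ u θ 0 →
    ∀ t ∈ Set.Ico 0 T, ∃ M : ℝ, 0 < M ∧ ∃ V₀ : ℝ, 0 < V₀ ∧ ∀ V : ℝ, V₀ ≤ V → ∀ ε : ℝ, 0 < ε →
    ∃ τ₀ : ℝ, 0 < τ₀ ∧ ∀ τ : ℝ, τ₀ ≤ τ → ∃ N₀ : ℕ, ∀ N : ℕ, N₀ ≤ N → ∀ s ∈ Set.Icc 0 t,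
      ∫⁻ z, ENNReal.ofReal (((N : ℝ) + 1)⁻¹ * ∑ i : Fin (N + 1),
          Set.indicator {y : ℝ | V < y} (fun y => y)
            (σ / τ * (Φ N).collisionSum (Set.Ioc s (s + τ * ((N : ℝ) + 1) ^ (-(1 / 3 : ℝ))))
              (hotSupplyOf M N i) z))
        ∂(localGibbsLaw σ a₀ u₀ θ₀ N (Φ N)) ≤ ENNReal.ofReal ε

/-- **K3 — PATHWISE SPLIT at a cap `M ≥ 0`.** For every good orbit, window `(a, b]` and particle:
`Σ|ΔE_i| ≤ ‖v_i(a)‖²/2 + 2M·Σ‖Δv_i‖ + 2·Σ hotSupply_M` (registered vocabulary of line Sketch, crux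
EnergyActivityTails (stmt-AtomisticToContinuum-17703) — route-internal, not a cited fact). -/
def PathwiseSplit : Prop :=
  ∀ (M : ℝ), 0 ≤ M → ∀ (σ : ℝ), 0 < σ → σ < 1 / 2 → ∀ (N : ℕ) (Φ : Flow σ N) (z : Cfg N), z ∈ Φ.good →
    ∀ (a b : ℝ), a ≤ b → ∀ i : Fin (N + 1),
      Φ.collisionSum (Set.Ioc a b) (energyOf N i) z ≤
        ‖(Φ.flow a z i).2‖ ^ 2 / 2 + 2 * M * Φ.collisionSum (Set.Ioc a b) (momentumOf N i) z +
          2 * Φ.collisionSum (Set.Ioc a b) (hotSupplyOf M N i) z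

/-- **MEASURABILITY OF THE HOT SUPPLY** (window sum over any `(a, b]`, extended by `0` off the good set;
`0 < σ < 1/2`) (registered vocabulary of line Sketch, crux EnergyActivityTails (stmt-AtomisticToContinuum-17703) —
route-internal, not a cited fact). -/
def HotSupplyMeasurable : Prop :=
  ∀ (σ : ℝ), 0 < σ → σ < 1 / 2 → ∀ (M : ℝ) (N : ℕ) (Φ : Flow σ N) (i : Fin (N + 1)) (a b : ℝ),
    Measurable (Φ.good.indicator fun z => Φ.collisionSum (Set.Ioc a b) (hotSupplyOf M N i) z)

/-! ## §1 Scalar tail algebra -/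

/-- **Three-term tail algebra with one untailed summand**: for `0 ≤ x₁, x₂, x₃` and `a ≤ x₁ + x₂ + x₃`,
`𝟙{V < a} a ≤ 3 (x₁ + 𝟙{V/3 < x₂} x₂ + 𝟙{V/3 < x₃} x₃)` (if `a > V`, every summand not exceeding `V/3` is `< a/3`,
so the remaining ones carry at least a third of `a`). -/
theorem tailFn_le_three_mul {V a x₁ x₂ x₃ : ℝ} (h₁ : 0 ≤ x₁) (h₂ : 0 ≤ x₂) (h₃ : 0 ≤ x₃)
    (ha : a ≤ x₁ + x₂ + x₃) :
    tailFn V a ≤ 3 * (x₁ + tailFn (V / 3) x₂ + tailFn (V / 3) x₃) := by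
  by_cases hVa : V < a
  · rw [tailFn_of_lt hVa]
    by_cases hx₂ : V / 3 < x₂
    · rw [tailFn_of_lt hx₂]
      by_cases hx₃ : V / 3 < x₃
      · rw [tailFn_of_lt hx₃]
        linarith
      · rw [tailFn_of_le (not_lt.1 hx₃)]
        linarith [not_lt.1 hx₃]
    · rw [tailFn_of_le (not_lt.1 hx₂)]
      by_cases hx₃ : V / 3 < x₃
      · rw [tailFn_of_lt hx₃]
        linarith [not_lt.1 hx₂]
      · rw [tailFn_of_le (not_lt.1 hx₃)]
        linarith [not_lt.1 hx₂, not_lt.1 hx₃]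
  · rw [tailFn_of_le (not_lt.1 hVa)]
    linarith [tailFn_nonneg (V := V / 3) h₂, tailFn_nonneg (V := V / 3) h₃]

/-- **Scaling a tail**: `𝟙{W < c y} (c y) ≤ c · 𝟙{W' < y} y` whenever `0 ≤ c`, `0 ≤ y` and `c W' ≤ W`. -/
theorem tailFn_const_mul_le {c W W' y : ℝ} (hc : 0 ≤ c) (hy : 0 ≤ y) (hW : c * W' ≤ W) :
    tailFn W (c * y) ≤ c * tailFn W' y := by
  by_cases h : W < c * y
  · rw [tailFn_of_lt h, tailFn_of_lt (lt_of_mul_lt_mul_left (hW.trans_lt h) hc)]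
  · rw [tailFn_of_le (not_lt.1 h)]
    exact mul_nonneg hc (tailFn_nonneg hy)

/-! ## §2 The three window activities -/

variable {σ : ℝ} {N : ℕ}

/-- The ENERGY activity `aᵉ_i` of `i` over the window `(s, s + w]`, `w = window τ N` (the crux's `act`). -/
def actE (Φ : Flow σ N) (τ s : ℝ) (i : Fin (N + 1)) (z : Cfg N) : ℝ :=
  σ / τ * Φ.collisionSum (Set.Ioc s (s + window τ N)) (energyOf N i) z

/-- The HOT-SUPPLY activity `h_i` of `i` at cap `M` over the window `(s, s + w]` (the summand of `HotSupplyTailsIn`). -/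
def actH (M : ℝ) (Φ : Flow σ N) (τ s : ℝ) (i : Fin (N + 1)) (z : Cfg N) : ℝ :=
  σ / τ * Φ.collisionSum (Set.Ioc s (s + window τ N)) (hotSupplyOf M N i) z

/-- The momentum activity `act` of the CAT line in terms of `momentumOf` (definitional). -/
theorem act_eq (Φ : Flow σ N) (τ s : ℝ) (i : Fin (N + 1)) (z : Cfg N) :
    act Φ τ s i z = σ / τ * Φ.collisionSum (Set.Ioc s (s + window τ N)) (momentumOf N i) z :=
  rfl

/-- The hot-supply activity is nonnegative (`σ, τ ≥ 0`). -/
theorem actH_nonneg (hσ : 0 ≤ σ) (M : ℝ) (Φ : Flow σ N) {τ : ℝ} (hτ : 0 ≤ τ) (s : ℝ) (i : Fin (N + 1))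
    (z : Cfg N) : 0 ≤ actH M Φ τ s i z :=
  mul_nonneg (div_nonneg hσ hτ) (collisionSum_nonneg Φ _ (fun c => by
    -- `0 ≤ hotSupplyOf M N i c` (= the landed `EnergyActivityTailsHotSupplyRungs.hotSupplyOf_nonneg`, inlined for this copy)
    unfold hotSupplyOf; split_ifs
    · exact le_max_right _ _
    · exact le_rfl) z)

/-- **The hot-supply activity is a.e.-measurable under the local Gibbs law** (`0 < σ < 1/2`): the good-set
extension by zero of the window sum is measurable (`HotSupplyMeasurable`) and agrees with it almost everywhere,
the law being carried by the good set. -/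
theorem aemeasurable_actH (hHM : HotSupplyMeasurable) (hσ : 0 < σ) (hσ2 : σ < 1 / 2) (a₀ θ₀ : T3 → ℝ)
    (u₀ : T3 → V3) (M : ℝ) (N : ℕ) (Φ : Flow σ N) (τ s : ℝ) (i : Fin (N + 1)) :
    AEMeasurable (actH M Φ τ s i) (localGibbsLaw σ a₀ u₀ θ₀ N Φ) := by
  have hm : AEMeasurable (Φ.good.indicator fun z =>
      Φ.collisionSum (Set.Ioc s (s + window τ N)) (hotSupplyOf M N i) z) (localGibbsLaw σ a₀ u₀ θ₀ N Φ) :=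
    (hHM σ hσ hσ2 M N Φ i s (s + window τ N)).aemeasurable
  have hg : AEMeasurable (fun z => Φ.collisionSum (Set.Ioc s (s + window τ N)) (hotSupplyOf M N i) z)
      (localGibbsLaw σ a₀ u₀ θ₀ N Φ) := by
    refine hm.congr ?_
    filter_upwards [ae_mem_good_localGibbsLaw σ a₀ θ₀ u₀ N Φ] with z hz
    exact Set.indicator_of_mem hz _
  exact hg.const_mul (σ / τ)

/-! ## §3 The pathwise tail split on the good set -/

/-- **Per-particle tail split on the good set.** At a cap `M > 0`, for `τ > 0` and every level `V`:
`𝟙{V < aᵉ_i} aᵉ_i ≤ 3 (σ/τ) ‖v_i(s)‖²/2 + 6M 𝟙{V/(6M) < aᵐ_i} aᵐ_i + 6 𝟙{V/6 < h_i} h_i`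
(the pathwise split in activity units, `tailFn_le_three_mul`, `tailFn_const_mul_le`). -/
theorem tailFn_actE_le (hPS : PathwiseSplit) (hσ : 0 < σ) (hσ2 : σ < 1 / 2) {M : ℝ} (hM : 0 < M)
    (Φ : Flow σ N) {τ : ℝ} (hτ : 0 < τ) (s V : ℝ) (i : Fin (N + 1)) {z : Cfg N} (hz : z ∈ Φ.good) :
    tailFn V (actE Φ τ s i z) ≤
      3 * (σ / τ * (‖(Φ.flow s z i).2‖ ^ 2 / 2)) + 6 * M * tailFn (V / (6 * M)) (act Φ τ s i z) +
        6 * tailFn (V / 6) (actH M Φ τ s i z) := by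
  have hM0 : M ≠ 0 := hM.ne'
  have hκ : 0 ≤ σ / τ := div_nonneg hσ.le hτ.le
  have hw : s ≤ s + window τ N := le_add_of_nonneg_right (window_pos hτ N).le
  have hsplit := hPS M hM.le σ hσ hσ2 N Φ z hz s (s + window τ N) hw i
  -- the split in activity units
  have h1 : actE Φ τ s i z ≤
      σ / τ * (‖(Φ.flow s z i).2‖ ^ 2 / 2) + 2 * M * act Φ τ s i z + 2 * actH M Φ τ s i z := by
    calc actE Φ τ s i z = σ / τ * Φ.collisionSum (Set.Ioc s (s + window τ N)) (energyOf N i) z := rfl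
      _ ≤ σ / τ * (‖(Φ.flow s z i).2‖ ^ 2 / 2 +
            2 * M * Φ.collisionSum (Set.Ioc s (s + window τ N)) (momentumOf N i) z +
            2 * Φ.collisionSum (Set.Ioc s (s + window τ N)) (hotSupplyOf M N i) z) :=
          mul_le_mul_of_nonneg_left hsplit hκ
      _ = σ / τ * (‖(Φ.flow s z i).2‖ ^ 2 / 2) + 2 * M * act Φ τ s i z + 2 * actH M Φ τ s i z := by
          rw [act_eq]
          unfold actH
          ring
  have ha₀ : 0 ≤ act Φ τ s i z := act_nonneg hσ.le Φ hτ.le s i z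
  have hh₀ : 0 ≤ actH M Φ τ s i z := actH_nonneg hσ.le M Φ hτ.le s i z
  have hx₁ : 0 ≤ σ / τ * (‖(Φ.flow s z i).2‖ ^ 2 / 2) := by positivity
  have hx₂ : 0 ≤ 2 * M * act Φ τ s i z := by positivity
  have hx₃ : 0 ≤ 2 * actH M Φ τ s i z := by positivity
  have h3 := tailFn_le_three_mul (V := V) hx₁ hx₂ hx₃ h1
  have ht₂ : tailFn (V / 3) (2 * M * act Φ τ s i z) ≤ 2 * M * tailFn (V / (6 * M)) (act Φ τ s i z) :=
    tailFn_const_mul_le (by positivity) ha₀ (le_of_eq (by field_simp; ring))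
  have ht₃ : tailFn (V / 3) (2 * actH M Φ τ s i z) ≤ 2 * tailFn (V / 6) (actH M Φ τ s i z) :=
    tailFn_const_mul_le (by norm_num) hh₀ (by linarith)
  linarith

/-- **Averaged tail split on the good set**: `(N+1)⁻¹ Σ_i 𝟙{V < aᵉ_i} aᵉ_i ≤ 3 (σ/τ) (N+1)⁻¹ E(z) + 6M·[CAT tail
sum at level V/(6M)] + 6·[hot-supply tail sum at level V/6]` — summing `tailFn_actE_le` over the particles and using
energy conservation `Σ_i ‖v_i(s)‖²/2 = E(Φ_s z) = E(z)` (`HardSphereFlow.configEnergy_flow`). -/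
theorem avg_tailFn_actE_le (hPS : PathwiseSplit) (hσ : 0 < σ) (hσ2 : σ < 1 / 2) {M : ℝ} (hM : 0 < M)
    (Φ : Flow σ N) {τ : ℝ} (hτ : 0 < τ) (s V : ℝ) {z : Cfg N} (hz : z ∈ Φ.good) :
    ((N : ℝ) + 1)⁻¹ * ∑ i, tailFn V (actE Φ τ s i z) ≤
      3 * (σ / τ) * ((N : ℝ) + 1)⁻¹ * configEnergy z +
        6 * M * (((N : ℝ) + 1)⁻¹ * ∑ i, tailFn (V / (6 * M)) (act Φ τ s i z)) +
        6 * (((N : ℝ) + 1)⁻¹ * ∑ i, tailFn (V / 6) (actH M Φ τ s i z)) := by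
  have hN : (0 : ℝ) ≤ ((N : ℝ) + 1)⁻¹ := by positivity
  calc ((N : ℝ) + 1)⁻¹ * ∑ i, tailFn V (actE Φ τ s i z)
      ≤ ((N : ℝ) + 1)⁻¹ * ∑ i, (3 * (σ / τ * (‖(Φ.flow s z i).2‖ ^ 2 / 2)) +
          6 * M * tailFn (V / (6 * M)) (act Φ τ s i z) + 6 * tailFn (V / 6) (actH M Φ τ s i z)) :=
        mul_le_mul_of_nonneg_left (Finset.sum_le_sum fun i _ => tailFn_actE_le hPS hσ hσ2 hM Φ hτ s V i hz) hN
    _ = 3 * (σ / τ) * ((N : ℝ) + 1)⁻¹ * configEnergy (Φ.flow s z) +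
        6 * M * (((N : ℝ) + 1)⁻¹ * ∑ i, tailFn (V / (6 * M)) (act Φ τ s i z)) +
        6 * (((N : ℝ) + 1)⁻¹ * ∑ i, tailFn (V / 6) (actH M Φ τ s i z)) := by
        simp only [Finset.sum_add_distrib, ← Finset.mul_sum, ← Finset.sum_div, configEnergy]
        ring
    _ = _ := by rw [Φ.configEnergy_flow hz s]

/-! ## §4 The stub -/

/-- **STUB K4 of line `Sketch` — tail assembly.** The pathwise split (K3), the measurability of the hot supply,
the momentum twin `CollisionActivityTails` and the hot-supply tails `HotSupplyTailsIn` imply the crux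
`EnergyActivityTails`: a.e. on the good set `(N+1)⁻¹ Σ 𝟙{V < aᵉ}aᵉ ≤ 3(σ/τ)(N+1)⁻¹ E + 6M·(CAT sum at V/(6M)) +
6·(HST sum at V/6)`; one `lintegral` split; the endpoint mean is `≤ 3 σ e₀ / τ ≤ ε/3` (`MeanEnergyBound`,
`τ ≥ 9σe₀/ε`), CAT at accuracy `ε/(18M)` and HSTin at accuracy `ε/18` give `ε/3` each;
`σ₀ := min (min σ₀ᵐ σ₀ʰ) (1/2)`, `V₀ := max (6M V₀ᵐ) (6 V₀ʰ)`, `τ₀ := max (max τ₀ᵐ τ₀ʰ) (9σe₀/ε)`, `N₀ := max`. -/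
theorem stub_tailAssembly : PathwiseSplit → HotSupplyMeasurable →
    Summit.AtomisticToContinuum.HydrodynamicLimit.Theses.OneFlightGossipEngine.CollisionActivityTails →
    HotSupplyTailsIn →
    Summit.AtomisticToContinuum.HydrodynamicLimit.Theses.OneFlightGossipEngine.EnergyActivityTails := by
  intro hPS hHM hCAT hHST
  have hC : TailsOf momentumOf := hCAT
  show TailsOf energyOf
  intro a₀ θ₀ u₀ ha hθ hu ha0 hθ0
  obtain ⟨σ₁, hσ₁, hC⟩ := hC a₀ θ₀ u₀ ha hθ hu ha0 hθ0
  obtain ⟨σ₂, hσ₂, hH⟩ := hHST a₀ θ₀ u₀ ha hθ hu ha0 hθ0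
  obtain ⟨e₀, he₀, hE⟩ := stub_meanEnergyBound a₀ θ₀ u₀ ha hθ hu ha0 hθ0
  refine ⟨min (min σ₁ σ₂) (1 / 2), lt_min (lt_min hσ₁ hσ₂) (by norm_num), ?_⟩
  intro σ hσ hσlt T ρ θ u hsol Φ hLLN t ht
  have hσ₁' : σ < σ₁ := hσlt.trans_le ((min_le_left _ _).trans (min_le_left _ _))
  have hσ₂' : σ < σ₂ := hσlt.trans_le ((min_le_left _ _).trans (min_le_right _ _))
  have hσ2 : σ < 1 / 2 := hσlt.trans_le (min_le_right _ _)
  have hσ2' : σ < 2⁻¹ := hσ2.trans_eq (one_div 2)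
  obtain ⟨V₁, hV₁, hC⟩ := hC σ hσ hσ₁' T ρ θ u hsol Φ hLLN t ht
  obtain ⟨M, hM, V₂, hV₂, hH⟩ := hH σ hσ hσ₂' T ρ θ u hsol Φ hLLN t ht
  have hM0 : M ≠ 0 := hM.ne'
  refine ⟨max (6 * M * V₁) (6 * V₂), lt_max_of_lt_left (by positivity), ?_⟩
  intro V hV ε hε
  have hV₁' : V₁ ≤ V / (6 * M) := by
    rw [le_div_iff₀ (by positivity)]
    calc V₁ * (6 * M) = 6 * M * V₁ := by ring
      _ ≤ V := le_of_max_le_left hV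
  have hV₂' : V₂ ≤ V / 6 := by
    have := le_of_max_le_right hV
    linarith
  obtain ⟨τ₁, hτ₁, hC⟩ := hC (V / (6 * M)) hV₁' (ε / (18 * M)) (by positivity)
  obtain ⟨τ₂, hτ₂, hH⟩ := hH (V / 6) hV₂' (ε / 18) (by positivity)
  refine ⟨max (max τ₁ τ₂) (9 * σ * e₀ / ε), lt_max_of_lt_left (lt_max_of_lt_left hτ₁), ?_⟩
  intro τ hτ
  have hτ₁' : τ₁ ≤ τ := (le_max_left _ _).trans ((le_max_left _ _).trans hτ)
  have hτ₂' : τ₂ ≤ τ := (le_max_right _ _).trans ((le_max_left _ _).trans hτ)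
  have hτe : 9 * σ * e₀ / ε ≤ τ := (le_max_right _ _).trans hτ
  have hτpos : 0 < τ := hτ₁.trans_le hτ₁'
  obtain ⟨N₁, hC⟩ := hC τ hτ₁'
  obtain ⟨N₂, hH⟩ := hH τ hτ₂'
  refine ⟨max N₁ N₂, fun N hN s hs => ?_⟩
  set P := localGibbsLaw σ a₀ u₀ θ₀ N (Φ N) with hP
  -- the three inputs in the vocabulary of this file (definitional unfoldings)
  have hCb : ∫⁻ z, ENNReal.ofReal (((N : ℝ) + 1)⁻¹ * ∑ i : Fin (N + 1),
      tailFn (V / (6 * M)) (act (Φ N) τ s i z)) ∂P ≤ ENNReal.ofReal (ε / (18 * M)) :=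
    hC N (le_of_max_le_left hN) s hs
  have hHb : ∫⁻ z, ENNReal.ofReal (((N : ℝ) + 1)⁻¹ * ∑ i : Fin (N + 1),
      tailFn (V / 6) (actH M (Φ N) τ s i z)) ∂P ≤ ENNReal.ofReal (ε / 18) :=
    hH N (le_of_max_le_right hN) s hs
  have hEb : ∫⁻ z, ENNReal.ofReal (configEnergy z) ∂P ≤ ENNReal.ofReal (e₀ * ((N : ℝ) + 1)) :=
    hE σ hσ hσ2.le N (Φ N)
  show ∫⁻ z, ENNReal.ofReal (((N : ℝ) + 1)⁻¹ * ∑ i : Fin (N + 1), tailFn V (actE (Φ N) τ s i z)) ∂P ≤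
    ENNReal.ofReal ε
  have hN1 : (0 : ℝ) < (N : ℝ) + 1 := by positivity
  have hc₁ : (0 : ℝ) ≤ 3 * (σ / τ) * ((N : ℝ) + 1)⁻¹ := by positivity
  -- measurability of the two tail sums
  have hG₂m : AEMeasurable (fun z => ENNReal.ofReal (6 * M * (((N : ℝ) + 1)⁻¹ * ∑ i : Fin (N + 1),
      tailFn (V / (6 * M)) (act (Φ N) τ s i z)))) P :=
    (((aemeasurable_sum_tailFn_act hσ hσ2' a₀ θ₀ u₀ N (Φ N) τ s _).const_mul _).const_mul _).ennreal_ofReal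
  have hG₃m : AEMeasurable (fun z => ENNReal.ofReal (6 * (((N : ℝ) + 1)⁻¹ * ∑ i : Fin (N + 1),
      tailFn (V / 6) (actH M (Φ N) τ s i z)))) P := by
    refine (((Finset.aemeasurable_fun_sum _ fun i _ => ?_).const_mul _).const_mul _).ennreal_ofReal
    exact (measurable_tailFn _).comp_aemeasurable (aemeasurable_actH hHM hσ hσ2 a₀ θ₀ u₀ M N (Φ N) τ s i)
  -- the pathwise split, a.e. (the good set carries the law)
  have hae : ∀ᵐ z ∂P, ((N : ℝ) + 1)⁻¹ * ∑ i : Fin (N + 1), tailFn V (actE (Φ N) τ s i z) ≤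
      3 * (σ / τ) * ((N : ℝ) + 1)⁻¹ * configEnergy z +
        6 * M * (((N : ℝ) + 1)⁻¹ * ∑ i : Fin (N + 1), tailFn (V / (6 * M)) (act (Φ N) τ s i z)) +
        6 * (((N : ℝ) + 1)⁻¹ * ∑ i : Fin (N + 1), tailFn (V / 6) (actH M (Φ N) τ s i z)) := by
    filter_upwards [ae_mem_good_localGibbsLaw σ a₀ θ₀ u₀ N (Φ N)] with z hz
    exact avg_tailFn_actE_le hPS hσ hσ2 hM (Φ N) hτpos s V hz
  -- one `lintegral` split
  have hsplit : ∫⁻ z, ENNReal.ofReal (((N : ℝ) + 1)⁻¹ * ∑ i : Fin (N + 1), tailFn V (actE (Φ N) τ s i z)) ∂P ≤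
      ∫⁻ z, ENNReal.ofReal (3 * (σ / τ) * ((N : ℝ) + 1)⁻¹ * configEnergy z) ∂P +
        ∫⁻ z, ENNReal.ofReal (6 * M * (((N : ℝ) + 1)⁻¹ * ∑ i : Fin (N + 1),
          tailFn (V / (6 * M)) (act (Φ N) τ s i z))) ∂P +
        ∫⁻ z, ENNReal.ofReal (6 * (((N : ℝ) + 1)⁻¹ * ∑ i : Fin (N + 1),
          tailFn (V / 6) (actH M (Φ N) τ s i z))) ∂P := by
    rw [← lintegral_add_right' _ hG₂m, ← lintegral_add_right' _ hG₃m]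
    refine lintegral_mono_ae (hae.mono fun z hz => (ENNReal.ofReal_le_ofReal hz).trans ?_)
    exact ENNReal.ofReal_add_le.trans (add_le_add ENNReal.ofReal_add_le le_rfl)
  -- the three prices
  have h1 : ∫⁻ z, ENNReal.ofReal (3 * (σ / τ) * ((N : ℝ) + 1)⁻¹ * configEnergy z) ∂P ≤ ENNReal.ofReal (ε / 3) := by
    refine (lintegral_ofReal_le_of_le_mul hc₁ (ae_of_all _ fun z => le_rfl) hEb).trans
      (ENNReal.ofReal_le_ofReal ?_)
    have h9 : 9 * σ * e₀ ≤ τ * ε := (div_le_iff₀ hε).1 hτe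
    have hkey : 3 * (σ / τ) * ((N : ℝ) + 1)⁻¹ * (e₀ * ((N : ℝ) + 1)) = 3 * σ * e₀ / τ := by
      field_simp
    rw [hkey, div_le_iff₀ hτpos]
    calc 3 * σ * e₀ = 9 * σ * e₀ / 3 := by ring
      _ ≤ τ * ε / 3 := by gcongr
      _ = ε / 3 * τ := by ring
  have h2 : ∫⁻ z, ENNReal.ofReal (6 * M * (((N : ℝ) + 1)⁻¹ * ∑ i : Fin (N + 1),
      tailFn (V / (6 * M)) (act (Φ N) τ s i z))) ∂P ≤ ENNReal.ofReal (ε / 3) := by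
    refine (lintegral_ofReal_le_of_le_mul (by positivity) (ae_of_all _ fun z => le_rfl) hCb).trans
      (ENNReal.ofReal_le_ofReal (le_of_eq ?_))
    field_simp
    ring
  have h3 : ∫⁻ z, ENNReal.ofReal (6 * (((N : ℝ) + 1)⁻¹ * ∑ i : Fin (N + 1),
      tailFn (V / 6) (actH M (Φ N) τ s i z))) ∂P ≤ ENNReal.ofReal (ε / 3) := by
    refine (lintegral_ofReal_le_of_le_mul (by norm_num) (ae_of_all _ fun z => le_rfl) hHb).trans
      (ENNReal.ofReal_le_ofReal (le_of_eq ?_))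
    ring
  calc _ ≤ _ := hsplit
    _ ≤ ENNReal.ofReal (ε / 3) + ENNReal.ofReal (ε / 3) + ENNReal.ofReal (ε / 3) :=
        add_le_add (add_le_add h1 h2) h3
    _ = ENNReal.ofReal ε := by
        rw [← ENNReal.ofReal_add (by positivity) (by positivity),
          ← ENNReal.ofReal_add (by positivity) (by positivity)]
        congr 1
        ring

end Summit.AtomisticToContinuum.HydrodynamicLimit.Theorems.EnergyActivityTailsTailAssembly

end
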